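import Literature.Analysis.FluidPDE.StretchedLayerEnergyClass
import HarnessLib

/-!
# Shear-layer tails: the physical side condition for the strained shear layer (one predicate serving both
# the energy method and the energy budget)

Analysis/FluidPDE file (one definition, everything else proved). The **shear-layer tails**
`StretchedLayer.HasShearLayerTails u v` of a velocity field of the stretched two-dimensional Navier–Stokes
layer system (`StretchedLayerNS`): for every `T > 0`,
(i) on `(0, T] × ℝ²` the velocity and its `y`-slice derivatives are bounded and the `x`-slice derivatives decay
like `C e^{−k|y|}` — clause (i) of `HasLayerEnergyTails` VERBATIM (first-order, uniform down to `t = 0⁺`);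
(ii) on `[δ, T] × ℝ²`, `δ > 0`: the shear quantities `u² + v² − ¼`, `v`, the velocity gradient, the pure second
slice derivatives and the time derivatives ALL decay like `C′ e^{−k′|y|}` — clause (ii) of `HasLayerEnergyTails`
upgraded from "bounded" to exponentially decaying, plus the shear quantities.

Why this predicate (design): it is the weakest velocity-level, pressure-free, `x`-translation-compatible side
condition under which BOTH standard tools run for one solution of the strained shear layer — the `L²` energy
method on the period strip (via `HasShearLayerTails.hasLayerEnergyTails`, hence period rigidity / uniqueness
relative to translates, `IsStretchedLayerNSSolutionOn.periodic_of_hasLayerEnergyTails`) and the exact energy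
budget `L·∫D = ∫J − ΔE` of the layer relative to the free streams `u = ±½` (which needs decay of `u² − ¼`, `v`,
`∇(u,v)`, `Δ`, `∂ₜ` on compact time intervals; Majda–Bertozzi 2002 §3.1.1 with the strain drift). It is satisfied
by the physical solution from a Gaussian-tailed shear-layer datum (vorticity confined by the compression `−y∂_y`,
velocity excess harmonic outside the vortical region, decaying like `e^{−2π|y|/L}`), by the Burgers layer and by
every strained parallel (Mehler) flow. It does NOT hold uniformly in `T` by fiat (constants may depend on `T` and
`δ`), and it says nothing about any `ν`-uniform dynamics. Deliberately NOT here: any statement that solutions of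
the stretched system acquire these tails (an a-priori theorem, not a definition). All folklore.
-/

noncomputable section

open Set Function Filter
open _root_.MeasureTheory
open scoped Topology

namespace Literature.Analysis.FluidPDE

namespace StretchedLayer

/-- **Shear-layer tails** of a velocity field `(u, v)` of the stretched layer system (a side condition on one
solution; no pressure clause): for every `T > 0`,
(i) on `(0, T] × ℝ²`: `|u| + |v| + |∂_yu| + |∂_yv| ≤ C` and `|∂ₓu| + |∂ₓv| ≤ C e^{−k|y|}` (= clause (i) of
`HasLayerEnergyTails`, uniform down to `t = 0⁺`, first-order quantities only);
(ii) on `[δ, T] × ℝ²`, `δ > 0`: `|u² + v² − ¼| + |v| + |∇(u,v)| + (pure second slice derivatives) + |∂ₜu| + |∂ₜv|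
≤ C′ e^{−k′|y|}`. Satisfied by the physical solution from a Gaussian-tailed shear-layer datum; Majda–Bertozzi's
finite-energy-perturbation class (2002, §3.1.3, Remark after Prop. 3.4) sharpened to exponential shear tails.
[folklore] -/
def HasShearLayerTails (u v : ℝ → ℝ → ℝ → ℝ) : Prop :=
  ∀ T : ℝ, 0 < T →
    (∃ C k : ℝ, 0 < k ∧ ∀ t ∈ Set.Ioc 0 T, ∀ x y : ℝ,
      |u t x y| + |v t x y| + |dY (u t) x y| + |dY (v t) x y| ≤ C ∧
      |dX (u t) x y| + |dX (v t) x y| ≤ C * Real.exp (-k * |y|)) ∧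
    (∀ δ : ℝ, 0 < δ → ∃ C' k' : ℝ, 0 < k' ∧ ∀ t ∈ Set.Icc δ T, ∀ x y : ℝ,
      |u t x y ^ 2 + v t x y ^ 2 - 1 / 4| + |v t x y| +
        (|dX (u t) x y| + |dY (u t) x y| + |dX (v t) x y| + |dY (v t) x y|) +
        (|dX (dX (u t)) x y| + |dY (dY (u t)) x y| + |dX (dX (v t)) x y| + |dY (dY (v t)) x y|) +
        (|deriv (fun s => u s x y) t| + |deriv (fun s => v s x y) t|) ≤ C' * Real.exp (-k' * |y|))

/-- Shear-layer tails imply the energy-class tails `HasLayerEnergyTails` (clause (i) verbatim; in clause (ii)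
`C′ e^{−k′|y|} ≤ C′`). Consequently the energy-class period rigidity
`IsStretchedLayerNSSolutionOn.periodic_of_hasLayerEnergyTails` applies to every solution with shear-layer tails.
[folklore] -/
theorem HasShearLayerTails.hasLayerEnergyTails {u v : ℝ → ℝ → ℝ → ℝ} (h : HasShearLayerTails u v) :
    HasLayerEnergyTails u v := by
  intro T hT
  obtain ⟨h1, h2⟩ := h T hT
  refine ⟨h1, fun δ hδ => ?_⟩
  obtain ⟨C', k', hk', hb⟩ := h2 δ hδ
  refine ⟨C', fun t ht x y => ?_⟩
  have key := hb t ht x y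
  have hexp : Real.exp (-k' * |y|) ≤ 1 :=
    Real.exp_le_one_iff.2 (by nlinarith [abs_nonneg y, hk'])
  have hpos : 0 < Real.exp (-k' * |y|) := Real.exp_pos _
  have hC' : 0 ≤ C' := by
    by_contra hneg
    push Not at hneg
    have : C' * Real.exp (-k' * |y|) < 0 := mul_neg_of_neg_of_pos hneg hpos
    linarith [abs_nonneg (u t x y ^ 2 + v t x y ^ 2 - 1 / 4), abs_nonneg (v t x y),
      abs_nonneg (dX (u t) x y), abs_nonneg (dY (u t) x y), abs_nonneg (dX (v t) x y),
      abs_nonneg (dY (v t) x y), abs_nonneg (dX (dX (u t)) x y), abs_nonneg (dY (dY (u t)) x y),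
      abs_nonneg (dX (dX (v t)) x y), abs_nonneg (dY (dY (v t)) x y),
      abs_nonneg (deriv (fun s => u s x y) t), abs_nonneg (deriv (fun s => v s x y) t)]
  have hle : C' * Real.exp (-k' * |y|) ≤ C' := mul_le_of_le_one_right hC' hexp
  linarith [abs_nonneg (u t x y ^ 2 + v t x y ^ 2 - 1 / 4), abs_nonneg (v t x y),
    abs_nonneg (dX (u t) x y), abs_nonneg (dY (u t) x y), abs_nonneg (dX (v t) x y),
    abs_nonneg (dY (v t) x y)]

/-- The clause-(ii) bound of shear-layer tails on `[δ, T]`, unpacked: one pair `C′, k′ > 0` bounding the shear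
quantity, `v`, the gradient, the Laplacians `|Δu| + |Δv|` (by `|∂ₓ∂ₓf| + |∂_y∂_yf|`) and the time derivatives by
`C′ e^{−k′|y|}` for all `t ∈ [δ, T]` — the form consumed by energy-budget arguments. [folklore] -/
theorem HasShearLayerTails.bounds_Icc {u v : ℝ → ℝ → ℝ → ℝ} (h : HasShearLayerTails u v) {δ T : ℝ}
    (hδ : 0 < δ) (hδT : δ ≤ T) :
    ∃ C' k' : ℝ, 0 < k' ∧ ∀ t ∈ Set.Icc δ T, ∀ x y : ℝ,
      |u t x y ^ 2 + v t x y ^ 2 - 1 / 4| ≤ C' * Real.exp (-k' * |y|) ∧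
      |v t x y| ≤ C' * Real.exp (-k' * |y|) ∧
      |dX (u t) x y| + |dY (u t) x y| + |dX (v t) x y| + |dY (v t) x y| ≤ C' * Real.exp (-k' * |y|) ∧
      |lap (u t) x y| + |lap (v t) x y| ≤ C' * Real.exp (-k' * |y|) ∧
      |deriv (fun s => u s x y) t| + |deriv (fun s => v s x y) t| ≤ C' * Real.exp (-k' * |y|) := by
  obtain ⟨-, h2⟩ := h T (hδ.trans_le hδT)
  obtain ⟨C', k', hk', hb⟩ := h2 δ hδ
  refine ⟨C', k', hk', fun t ht x y => ?_⟩
  have key := hb t ht x y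
  have hlu : |lap (u t) x y| ≤ |dX (dX (u t)) x y| + |dY (dY (u t)) x y| := abs_add_le _ _
  have hlv : |lap (v t) x y| ≤ |dX (dX (v t)) x y| + |dY (dY (v t)) x y| := abs_add_le _ _
  have n1 := abs_nonneg (u t x y ^ 2 + v t x y ^ 2 - 1 / 4)
  have n2 := abs_nonneg (v t x y)
  have n3 := abs_nonneg (dX (u t) x y)
  have n4 := abs_nonneg (dY (u t) x y)
  have n5 := abs_nonneg (dX (v t) x y)
  have n6 := abs_nonneg (dY (v t) x y)
  have n7 := abs_nonneg (dX (dX (u t)) x y)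
  have n8 := abs_nonneg (dY (dY (u t)) x y)
  have n9 := abs_nonneg (dX (dX (v t)) x y)
  have n10 := abs_nonneg (dY (dY (v t)) x y)
  have n11 := abs_nonneg (deriv (fun s => u s x y) t)
  have n12 := abs_nonneg (deriv (fun s => v s x y) t)
  exact ⟨by linarith, by linarith, by linarith, by linarith, by linarith⟩

end StretchedLayer

end Literature.Analysis.FluidPDE

end
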